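import Summits.KontsevichZagierPeriods.KontsevichZagierPeriods.Theses.HurwitzMicroSectors
import Summits.KontsevichZagierPeriods.KontsevichZagierPeriods.Theorems.HurwitzMicroSectorsNormalFormPrinciplePiBoxTransfer
import Literature.NumberTheory.Transcendental.KZRulesAssociator

/-! TTRL-lite variant V2226 of stmt-KontsevichZagierPeriods-3869

Variant V2226 = `stub_boxRigidity` (the leaf `BoxRigidity` of `NormalFormPrinciple`: two representations on
open unit boxes with integrands of KZ's rational shape `p/q` AND EQUAL VALUES are KZ-equivalent) under the
move `drop_hyp:4` — the hypothesis `N.value = N'.value` is dropped. The variant is **false**: the KZ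
calculus is sound (`Equivalent.value_eq_holds`: equivalent representations have equal values), while the
0-dimensional unit box `ℝ⁰ = {pt}` carries two box-rational representations with different values, the unit
representation `[pt, 1]` (`IntegralRep.unit`, value `1`) and the zero representation `[pt, 0]` (value `0`).
Source: M. Kontsevich, D. Zagier, *Periods* (2001), §1.2 (soundness of the rules). Pure proof file. -/

-- `Summit.<Summit>.<Problem>` is the tree's mandated summit-side namespace (CONVENTIONS §2); for this
-- single-conjunct summit the two coincide, so the duplicate is deliberate.
set_option linter.dupNamespace false

noncomputable section

namespace Summit.KontsevichZagierPeriods.KontsevichZagierPeriods.Theorems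

open MeasureTheory Set
open Literature.NumberTheory.Transcendental Literature.NumberTheory.Transcendental.KZ
open Summit.KontsevichZagierPeriods.KontsevichZagierPeriods.Theses.HurwitzMicroSectors

/-- **V2226 is false**: dropping `N.value = N'.value` from `BoxRigidity` would make the box-rational
representations `[pt, 1]` (value `1`) and `[pt, 0]` (value `0`) on the `0`-dimensional unit box
KZ-equivalent, contradicting soundness of the calculus (`Equivalent.value_eq_holds`).
[cite: KontsevichZagier2001, §1.2] -/
theorem stub_boxRigidity_var2226_false :
    ¬ (∀ (m m' : ℕ) (N : IntegralRep m) (N' : IntegralRep m'), N.domain = {x | ∀ i, x i ∈ Set.Ioo (0:ℝ) 1} → N.IsRational → N'.domain = {x | ∀ i, x i ∈ Set.Ioo (0:ℝ) 1} → N'.IsRational → Equivalent N N') := by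
  intro h
  -- the zero representation `[pt, 0]` on the `0`-dimensional box
  obtain ⟨Z, hZd, hZi⟩ := exists_zeroRep (isSemialgebraic_box 0)
  have hZr : Z.IsRational := ⟨0, 1, fun x _ => by simp, fun x _ => by simp [hZi]⟩
  have hZv : Z.value = 0 := by simp [IntegralRep.value, hZi]
  -- the unit representation `[pt, 1]` is box-rational on the same box
  have hUd : IntegralRep.unit.domain = {x : Fin 0 → ℝ | ∀ i, x i ∈ Set.Ioo (0:ℝ) 1} := by
    ext x
    simp
  have hUr : IntegralRep.unit.IsRational := ⟨1, 1, fun x _ => by simp, fun x _ => by simp⟩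
  have hE : Equivalent IntegralRep.unit Z := h 0 0 IntegralRep.unit Z hUd hUr hZd hZr
  have hv : IntegralRep.unit.value = Z.value := Equivalent.value_eq_holds hE
  rw [IntegralRep.value_unit, hZv] at hv
  exact one_ne_zero hv

end Summit.KontsevichZagierPeriods.KontsevichZagierPeriods.Theorems

end
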